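import Mathlib
import Summits.Ventures.PercRepro2.Defs
import Summits.Ventures.PercRepro2.Independence
import Summits.Ventures.PercRepro2.Harris
import Summits.Ventures.PercRepro2.Graph
import Summits.Ventures.PercRepro2.Exploration
import Summits.Ventures.PercRepro2.Events
import Summits.Ventures.PercRepro2.Induced
import Summits.Ventures.PercRepro2.BHKEvents
import Summits.Ventures.PercRepro2.R4Defs
import Summits.Ventures.PercRepro2.R4Ladder
import Summits.Ventures.PercRepro2.StarRoot
import Summits.Ventures.PercRepro2.StarCells
import Summits.Ventures.PercRepro2.StarProb

/-!
# Star-attached roots: the flip mass `LOSS` (blind cell PercRepro2, p1)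

For a star-attached root (`N(o) ⊆ {a₁, a₂, b}`) the only cluster `W = C(o)` disjoint from
`{a₁, a₂}` that contributes to `LOSS(a₁) = ∑_W P(C(o) = W) (P_{G∖W}(a₁ ↔ b) − P_{G∖W}(a₂ ↔ b))⁺`
is `W = {o}`: a larger cluster of `o` avoiding `a₁, a₂` must contain `b` (the only other
neighbour of `o`), and then both `G ∖ W`-connection events are empty. At `W = {o}`,
`P(C(o) = {o}) = (1−α)(1−β)(1−γ)` and `P_{G∖o}(a₁ ↔ b) − P_{G∖o}(a₂ ↔ b) = P₂ − P₁`, whence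
`LOSS = (1−α)(1−β)(1−γ) (P₂ − P₁)⁺` (LEAD-PROOFSHAPES §8.7 (9)).
-/

namespace Summit.Ventures.PercRepro2

section StarLoss

variable {V : Type*} {E : Type*} [Fintype E] [DecidableEq E] [Fintype V] [DecidableEq V]
  {ends : E → Sym2 V} {o a₁ a₂ b : V}

omit [Fintype E] [DecidableEq E] [Fintype V] [DecidableEq V] in
/-- `{C(o) = W}` is empty when `o ∉ W`. -/
lemma clusterEvent_eq_empty_of_notMem {W : Set V} (ho : o ∉ W) :
    clusterEvent ends o W = ∅ := by
  ext ω
  simp only [mem_clusterEvent, Set.mem_empty_iff_false, iff_false]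
  intro h
  exact ho (h ▸ mem_cluster_self ends ω o)

omit [Fintype E] [DecidableEq E] [Fintype V] in
/-- For a star-attached root, a cluster `C(o) = W ≠ {o}` avoiding `a₁, a₂` contains `b`. -/
lemma clusterEvent_star_eq_empty (hS : StarAttached ends o {a₁, a₂, b}) {W : Finset V}
    (hoW : o ∈ W) (hW : W ≠ {o}) (hdisj : Disjoint W {a₁, a₂}) (hb : b ∉ W) :
    clusterEvent ends o ↑W = ∅ := by
  ext ω
  simp only [mem_clusterEvent, Set.mem_empty_iff_false, iff_false]
  intro h
  -- some `y ∈ W`, `y ≠ o`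
  obtain ⟨y, hyW, hyo⟩ : ∃ y ∈ W, y ≠ o := by
    by_contra hcon
    simp only [not_exists, not_and, not_not] at hcon
    exact hW (Finset.eq_singleton_iff_unique_mem.2 ⟨hoW, hcon⟩)
  have hy : y ∈ cluster ends ω o := by rw [h]; exact Finset.mem_coe.2 hyW
  obtain ⟨x, hxS, hhit, _⟩ := (conn_to_star hS hyo).1 (conn_symm hy)
  have hx : x ∈ cluster ends ω o := conn_of_openAdj hhit
  rw [h] at hx
  have hxW : x ∈ W := Finset.mem_coe.1 hx
  simp only [Finset.mem_insert, Finset.mem_singleton] at hxS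
  rcases hxS with rfl | rfl | rfl
  · exact Finset.disjoint_left.1 hdisj hxW (Finset.mem_insert_self _ _)
  · exact Finset.disjoint_left.1 hdisj hxW (Finset.mem_insert_of_mem (Finset.mem_singleton_self _))
  · exact hb hxW

omit [Fintype E] [DecidableEq E] [Fintype V] in
/-- For a star-attached root, `{C(o) = {o}}` is `{no edge at `o` is open}`. -/
lemma clusterEvent_singleton_eq (hS : StarAttached ends o {a₁, a₂, b})
    (ho : o ∉ ({a₁, a₂, b} : Finset V)) :
    clusterEvent ends o ↑({o} : Finset V) =
      (hitEdge ends o a₂)ᶜ ∩ (hitEdge ends o b)ᶜ ∩ (hitEdge ends o a₁)ᶜ := by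
  ext ω
  simp only [mem_clusterEvent, Finset.coe_singleton, Set.mem_inter_iff, Set.mem_compl_iff]
  constructor
  · intro h
    have key : ∀ x ∈ ({a₁, a₂, b} : Finset V), ω ∉ hitEdge ends o x := by
      intro x hx hhit
      have : x ∈ cluster ends ω o := conn_of_openAdj hhit
      rw [h, Set.mem_singleton_iff] at this
      exact ho (this ▸ hx)
    exact ⟨⟨key a₂ (Finset.mem_insert_of_mem (Finset.mem_insert_self _ _)),
      key b (Finset.mem_insert_of_mem (Finset.mem_insert_of_mem (Finset.mem_singleton_self _)))⟩,
      key a₁ (Finset.mem_insert_self _ _)⟩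
  · rintro ⟨⟨hA, hB⟩, hG⟩
    refine Set.eq_singleton_iff_unique_mem.2 ⟨mem_cluster_self ends ω o, fun y hy => ?_⟩
    by_contra hyo
    obtain ⟨x, hxS, hhit, _⟩ := (conn_to_star hS hyo).1 (conn_symm hy)
    simp only [Finset.mem_insert, Finset.mem_singleton] at hxS
    rcases hxS with rfl | rfl | rfl
    · exact hG hhit
    · exact hA hhit
    · exact hB hhit

omit [Fintype E] [DecidableEq E] in
/-- `restrict` to the edges not touching `{o}` is `delConfig ends {o}`. -/
lemma restrict_singleton_eq_delConfig (ω : Config E) :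
    restrict (touches ends ↑({o} : Finset V))ᶜ ω = delConfig ends {o} ω := by
  funext e
  by_cases h : e ∈ touches ends ({o} : Set V)
  · rw [delConfig_apply_of_mem h, restrict_apply_of_notMem]
    simp only [Set.mem_compl_iff, Finset.coe_singleton, not_not]
    exact h
  · rw [delConfig_apply_of_notMem h, restrict_apply_of_mem]
    simp only [Set.mem_compl_iff, Finset.coe_singleton]
    exact h

omit [Fintype E] [DecidableEq E] in
/-- `{u ↔ w in G ∖ {o}}` is the connection event of `ω' = delConfig ends {o} ω`. -/
lemma connDelEvent_singleton_eq (u w : V) :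
    connDelEvent ends {o} u w = {ω | Conn ends (delConfig ends {o} ω) u w} := by
  ext ω
  simp only [mem_connDelEvent, Set.mem_setOf_eq, restrict_singleton_eq_delConfig]

variable {R : Type*} [CommRing R]

omit [Fintype V] in
/-- Three events determined by the edge sets at `o` towards `a₂`, `b`, `a₁` are independent. -/
lemma prob_hit_triple (p : E → R) (ends : E → Sym2 V) {o a₁ a₂ b : V}
    (ho : o ∉ ({a₁, a₂, b} : Finset V)) (hab : a₂ ≠ b) (h12 : a₁ ≠ a₂) (h1b : a₁ ≠ b)
    (A B C : Set (Config E)) (hA : DependsOn (· ∈ A) (hitEdges ends o a₂))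
    (hB : DependsOn (· ∈ B) (hitEdges ends o b)) (hC : DependsOn (· ∈ C) (hitEdges ends o a₁)) :
    prob p (A ∩ B ∩ C) = prob p A * prob p B * prob p C := by
  have ha₂ : a₂ ≠ o := fun h => ho (h ▸ Finset.mem_insert_of_mem (Finset.mem_insert_self _ _))
  have hb : b ≠ o := fun h => ho (h ▸ Finset.mem_insert_of_mem (Finset.mem_insert_of_mem
    (Finset.mem_singleton_self _)))
  have h1 : prob p (A ∩ B ∩ C) = prob p (A ∩ B) * prob p C := by
    refine prob_inter_eq_mul_of_dependsOn p (F₁ := hitEdges ends o a₂ ∪ hitEdges ends o b)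
      (F₂ := hitEdges ends o a₁) ?_ (dependsOn_inter hA hB) hC
    rw [Set.disjoint_union_left]
    exact ⟨disjoint_hitEdges ends h12.symm ha₂, disjoint_hitEdges ends h1b.symm hb⟩
  rw [h1, prob_hitEdge_inter p ends hab ha₂ _ _ hA hB]

omit [Fintype V] in
/-- `P(C(o) = {o}) = (1−α)(1−β)(1−γ)`. -/
lemma prob_clusterEvent_singleton (p : E → R) (hS : StarAttached ends o {a₁, a₂, b})
    (ho : o ∉ ({a₁, a₂, b} : Finset V)) (hab : a₂ ≠ b) (h12 : a₁ ≠ a₂) (h1b : a₁ ≠ b) :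
    prob p (clusterEvent ends o ↑({o} : Finset V)) =
      (1 - prob p (hitEdge ends o a₂)) * (1 - prob p (hitEdge ends o b)) *
        (1 - prob p (hitEdge ends o a₁)) := by
  rw [clusterEvent_singleton_eq hS ho, prob_hit_triple p ends ho hab h12 h1b _ _ _
    (dependsOn_compl (dependsOn_hitEdge ends o a₂)) (dependsOn_compl (dependsOn_hitEdge ends o b))
    (dependsOn_compl (dependsOn_hitEdge ends o a₁)), prob_compl, prob_compl, prob_compl]

/-- `P_{G∖o}(a₁ ↔ b) − P_{G∖o}(a₂ ↔ b) = P₂ − P₁`. -/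
lemma prob_connDel_singleton_sub (p : E → R) (ends : E → Sym2 V) (o a₁ a₂ b : V) :
    prob p (connDelEvent ends {o} a₁ b) - prob p (connDelEvent ends {o} a₂ b) =
      prob p (stateOneB ends o a₁ a₂ b) - prob p (stateTwoB ends o a₁ a₂ b) := by
  rw [connDelEvent_singleton_eq, connDelEvent_singleton_eq]
  have h1 := prob_inter_add_prob_inter_compl p {ω | Conn ends (delConfig ends {o} ω) a₁ b}
    {ω | Conn ends (delConfig ends {o} ω) a₂ b}
  have h2 := prob_inter_add_prob_inter_compl p {ω | Conn ends (delConfig ends {o} ω) a₂ b}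
    {ω | Conn ends (delConfig ends {o} ω) a₁ b}
  have e1 : {ω | Conn ends (delConfig ends {o} ω) a₁ b} ∩
      {ω | Conn ends (delConfig ends {o} ω) a₂ b}ᶜ = stateOneB ends o a₁ a₂ b := rfl
  have e2 : {ω | Conn ends (delConfig ends {o} ω) a₂ b} ∩
      {ω | Conn ends (delConfig ends {o} ω) a₁ b}ᶜ = stateTwoB ends o a₁ a₂ b := rfl
  have e3 : {ω | Conn ends (delConfig ends {o} ω) a₂ b} ∩
      {ω | Conn ends (delConfig ends {o} ω) a₁ b} =
      {ω | Conn ends (delConfig ends {o} ω) a₁ b} ∩ {ω | Conn ends (delConfig ends {o} ω) a₂ b} :=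
    Set.inter_comm _ _
  rw [e1] at h1
  rw [e2, e3] at h2
  linear_combination h2 - h1

end StarLoss

section StarLossTerm

variable {V : Type*} {E : Type*} [Fintype E] [DecidableEq E] [Fintype V] [DecidableEq V]
  {ends : E → Sym2 V} {o a₁ a₂ b : V} {R : Type*} [Field R] [LinearOrder R]

/-- **`LOSS` for a star-attached root**: `LOSS(a₁) = (1−α)(1−β)(1−γ) (P₂ − P₁)⁺`. -/
theorem lossTerm_star (p : E → R) (hS : StarAttached ends o {a₁, a₂, b})
    (ho : o ∉ ({a₁, a₂, b} : Finset V)) (hab : a₂ ≠ b) (h12 : a₁ ≠ a₂) (h1b : a₁ ≠ b) :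
    lossTerm p ends o a₁ a₂ b =
      (1 - prob p (hitEdge ends o a₂)) * (1 - prob p (hitEdge ends o b)) *
        (1 - prob p (hitEdge ends o a₁)) *
        max 0 (prob p (stateOneB ends o a₁ a₂ b) - prob p (stateTwoB ends o a₁ a₂ b)) := by
  unfold lossTerm
  rw [Finset.sum_eq_single ({o} : Finset V)]
  · rw [prob_clusterEvent_singleton p hS ho hab h12 h1b, prob_connDel_singleton_sub]
  · intro W hW hWo
    have hdisj : Disjoint W {a₁, a₂} := (Finset.mem_filter.1 hW).2
    by_cases hoW : o ∈ W
    · by_cases hbW : b ∈ W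
      · rw [connDelEvent_eq_empty ends (Finset.disjoint_right.1 hdisj (Finset.mem_insert_self _ _))
          hbW, connDelEvent_eq_empty ends (Finset.disjoint_right.1 hdisj
          (Finset.mem_insert_of_mem (Finset.mem_singleton_self _))) hbW, prob_empty, sub_zero,
          max_self, mul_zero]
      · rw [clusterEvent_star_eq_empty hS hoW hWo hdisj hbW, prob_empty, zero_mul]
    · rw [clusterEvent_eq_empty_of_notMem (by simpa using hoW), prob_empty, zero_mul]
  · intro h
    exfalso
    apply h
    rw [Finset.mem_filter, Finset.disjoint_singleton_left]
    refine ⟨Finset.mem_univ _, fun ho' => ?_⟩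
    simp only [Finset.mem_insert, Finset.mem_singleton] at ho'
    rcases ho' with rfl | rfl
    · exact ho (Finset.mem_insert_self _ _)
    · exact ho (Finset.mem_insert_of_mem (Finset.mem_insert_self _ _))

end StarLossTerm

end Summit.Ventures.PercRepro2
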